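import Summits.QuantumFields.YangMills.Theorems.LuscherReductionTraceDoorKT
import Summits.QuantumFields.YangMills.Theorems.LuscherReductionTraceDoorInvPrep
import Summits.QuantumFields.YangMills.Theorems.LuscherReductionTraceDoorOST
import Literature.Analysis.Asymptotics.LaplaceAtomsFromDyadicRatios
import HarnessLib

/-!
# Glue item `TraceDoorGlue` (route `LuscherReduction`, stmt-QuantumFields-20206) — CLOSED: trace inversion + the TT-door composition

Route `LuscherReduction` (owner ym-beyond-p1), RED `RunningReduction` (stmt-QuantumFields-19978) split (route rev 11/12) along the TT door of the
registered skeleton «KTR» rev 8 (`pub/ym-beyond/p1-g19-files/Lines-KTR-r8.lean`, sha16 4d4e029b06d8e70b); glue item `TraceDoorGlue`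
(stmt-QuantumFields-20206) = `TraceFormula → TwistedTraceScaling → OneSiteTail → DressedRitz → RunningReduction`, landed under `Theorems/` as the
file family `LuscherReductionTraceDoor{Defs,Enclosure,Basics,InvAtoms,KT,InvPrep,OST,Glue}.lean` (namespace `…Theorems.FemtoTransferGap.TraceDoor`),
skeleton parts re-homed VERBATIM with the four children taken as the ROUTE DECLS (hypotheses), the skeleton's `Prop` currencies
(`CoarseNoIntruder`, `OneSiteLowerCoarse`, `CoarseLevels`, `OneSiteTraceLimit`) spelled out as texts, the door / Ritz basics / `LevelGapSummable` / ONE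
taken from the tree (`KTDoorR3.katoTempleDoorR3`, `KTDoorR3.ritzBasicsR3`, `LGS.levelGapSummable_all`, `oneSiteLevels_proof`).

THIS FILE: `traceInversion` (skeleton PART 6 §6.3 over the landed Tauberian theorem `laplaceAtoms`), `coarseLevels_of_children`
(`TraceFormula → TwistedTraceScaling → OneSiteTail → ⟨CoarseLevels text⟩`, ONE closed), and the deciding theorem of the glue item
`traceDoorGlue_proof : Summit.QuantumFields.YangMills.Theses.LuscherReduction.TraceDoorGlue`.

HONEST FRAMING: femto rung R2b1 (`FemtoGapOfRecord`) bookkeeping — the XL content (`TwistedTraceScaling`, `DressedRitz`) is ASSUMED, not proved;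
nothing here bears on infinite volume, the continuum limit or the Clay mass gap.  Sorry-free, no new definitions.
-/

set_option autoImplicit false

noncomputable section

open MeasureTheory Filter Topology Real
open Literature.MathematicalPhysics.QuantumFieldTheory hiding SU2
open Literature.MathematicalPhysics.QuantumLattice
open Literature.Analysis.OperatorTheory.YMMatrixModel
open scoped BigOperators

namespace Summit.QuantumFields.YangMills.Theorems.FemtoTransferGap.TraceDoor

open Summit.QuantumFields.YangMills.Theorems.FemtoTransferGap
open Summit.QuantumFields.YangMills.Theorems.FemtoTransferGap.TT (physTrace)

/-! ## §1 Trace inversion (skeleton PART 6 §6.3) -/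

/-- ★ **Trace inversion (skeleton PART 6 §6.3 `Inv.traceInversion`, VERBATIM; `LevelGapSummable` from the tree).**  The route children `TraceFormula`
and `TwistedTraceScaling` and the `OneSiteTraceLimit` text imply the coarse two-sided Lüscher law `CoarseLevels` for every level: by contradiction —
extract a violating sequence of windows along which TTS holds diagonally on the dyadic grid, form the regularised femto atoms `ã_j`
(`c_n = L/λ → ∞`, regularisation scales `δ_n → 0`), convert currencies (`traceRatio = levelRatio` under `TraceFormula`), pass to the one-site
limit `r_𝔥(q)` at every grid time, select diagonally, and apply the landed Tauberian theorem `Literature.Analysis.Asymptotics.LaplaceAtoms.laplaceAtoms`: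
every atom sequence converges to `Δ_j`, contradicting `far_of_violation` at level `k`. [cite: Feller1971, XIII.1 Thm 2a] [cite: Luscher1983, §3] -/
theorem traceInversion (hTF : Summit.QuantumFields.YangMills.Theses.LuscherReduction.TraceFormula) (hTS : Summit.QuantumFields.YangMills.Theses.LuscherReduction.TwistedTraceScaling)
    (hOS : (∀ s : ℝ, 0 < s → ∀ ε : ℝ, 0 < ε → ∃ B0 : ℝ, ∀ B : ℝ, B0 ≤ B → ∀ T : ℕ,
      |(T : ℝ) * bareLambda B - s| ≤ bareLambda B → |levelRatio 1 B T - hTraceRatio s| ≤ ε)) :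
    (∀ k : ℕ, ∀ η : ℝ, 0 < η → ∃ lam0 : ℝ, 0 < lam0 ∧ ∀ lam : ℝ, 0 < lam → lam ≤ lam0 →
      ∃ L0 : ℕ, ∀ (L : ℕ) [NeZero L], L0 ≤ L → ∀ β : ℝ, InFemtoWindow lam β L →
        Real.exp (-((levelGap k + η) * luscherLambda β L) / L) * levelValue su2Rep L β 0 ≤ levelValue su2Rep L β k ∧
          levelValue su2Rep L β k ≤ Real.exp (-((levelGap k - η) * luscherLambda β L) / L) * levelValue su2Rep L β 0) := by
  classical
  have hLG := Summit.QuantumFields.YangMills.Theorems.FemtoTransferGap.LGS.levelGapSummable_all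
  intro k η hη
  by_contra hviol
  obtain ⟨lam, L, β, hP⟩ := extract hTS hviol
  have hlam : ∀ n, 0 < lam n := fun n => (hP n).1
  have hlamle : ∀ n, lam n ≤ 1 / ((n : ℝ) + 1) := fun n => (hP n).2.1
  have hnL : ∀ n, n ≤ L n := fun n => (hP n).2.2.1
  have hW : ∀ n, InFemtoWindow (lam n) (β n) (L n + 1) := fun n => (hP n).2.2.2.1
  have hV := fun n => (hP n).2.2.2.2.1
  have hTTS := fun n => (hP n).2.2.2.2.2
  have hlam1 : ∀ n, lam n ≤ 1 := fun n => (hlamle n).trans (by rw [div_le_one (by positivity)]; linarith)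
  have hΛpos : ∀ n, 0 < luscherLambda (β n) (L n + 1) := fun n => luscherLambda_pos_of_window (hlam n) (hW n)
  have hΛle2 : ∀ n, luscherLambda (β n) (L n + 1) ≤ 2 := fun n => by linarith [(hW n).2.2, hlam1 n]
  have hβ1 : ∀ n, 1 ≤ β n := fun n => (hW n).1
  have hβ0 : ∀ n, 0 < β n := fun n => zero_lt_one.trans_le (hβ1 n)
  have hLpos : ∀ n, (0 : ℝ) < ((L n + 1 : ℕ) : ℝ) := fun n => by positivity
  -- the conversion factor `c_n = L/λ → ∞`
  obtain ⟨c, hc⟩ : ∃ c : ℕ → ℝ, ∀ n, c n = ((L n + 1 : ℕ) : ℝ) / luscherLambda (β n) (L n + 1) := ⟨_, fun _ => rfl⟩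
  have hcpos : ∀ n, 0 < c n := fun n => by rw [hc]; exact div_pos (hLpos n) (hΛpos n)
  have hcge : ∀ n : ℕ, ((n : ℝ) + 1) / 2 ≤ c n := fun n => by
    rw [hc, div_le_div_iff₀ (by norm_num : (0 : ℝ) < 2) (hΛpos n)]
    have h2 : (n : ℝ) + 1 ≤ ((L n + 1 : ℕ) : ℝ) := by exact_mod_cast Nat.succ_le_succ (hnL n)
    nlinarith [hΛle2 n, hΛpos n]
  have hnat : Tendsto (fun n : ℕ => (n : ℝ) + 1) atTop atTop := tendsto_natCast_atTop_atTop.atTop_add tendsto_const_nhds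
  have hc_top : Tendsto c atTop atTop := tendsto_atTop_mono hcge (hnat.atTop_div_const (by norm_num))
  have hc_inv : Tendsto (fun n => 1 / c n) atTop (𝓝 0) := by
    simpa only [one_div, Function.comp_def] using tendsto_inv_atTop_zero.comp hc_top
  -- the one-site couplings `B_n → ∞`, `λ_bare(B_n) = 1/c_n`
  have hbare : ∀ n, bareLambda (oneSiteCoupling (β n) (L n + 1)) = 1 / c n := fun n => by
    rw [bareLambda_oneSiteCoupling (hΛpos n), hc, one_div_div]
  have hB_top : Tendsto (fun n => oneSiteCoupling (β n) (L n + 1)) atTop atTop := by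
    have hlow : ∀ n : ℕ, ((n : ℝ) + 1) / 4 ≤ oneSiteCoupling (β n) (L n + 1) := by
      intro n
      have h1 := oneSiteCoupling_ge_of_window (hlam n) (hW n)
      have hl := hlam n
      have h3 : lam n ^ 3 ≤ lam n := by
        have := pow_le_pow_of_le_one hl.le (hlam1 n) (by norm_num : 1 ≤ 3); simpa using this
      have h4 : ((n : ℝ) + 1) * lam n ≤ 1 := by
        have := hlamle n; rw [le_div_iff₀ (by positivity)] at this; linarith
      calc ((n : ℝ) + 1) / 4 ≤ 1 / (4 * lam n) := by
            rw [div_le_div_iff₀ (by norm_num) (by positivity)]; nlinarith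
        _ ≤ 1 / (4 * lam n ^ 3) := by
            apply one_div_le_one_div_of_le (by positivity); nlinarith
        _ ≤ _ := h1
    exact tendsto_atTop_mono hlow (hnat.atTop_div_const (by norm_num))
  -- regularisation scales `δ_n → 0` and the atoms
  have hx2 : ∀ n, Summable fun j => xval (L n + 1) (β n) j ^ 2 := fun n => (hasSum_xval_pow hTF (hβ1 n) le_rfl).summable
  have hδex := fun n : ℕ => exists_delta (fun j => xval_nonneg (L := L n + 1) (hβ0 n) j) (hx2 n)
    (one_div_pos.mpr (hcpos n)) (by positivity : (0 : ℝ) < (n : ℝ) + 1) (by positivity : (0 : ℝ) < 1 / ((n : ℝ) + 1))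
  choose δ hδpos hδ1 hδε hS1 hS2 hFG using hδex
  have hδ0 : Tendsto δ atTop (𝓝 0) := squeeze_zero (fun n => (hδpos n).le) hδε tendsto_one_div_add_atTop_nhds_zero_nat
  obtain ⟨a, ha⟩ : ∃ a : ℕ → ℕ → ℝ, ∀ n, a n = atomReg (L n + 1) (β n) (c n) (δ n) := ⟨_, fun _ => rfl⟩
  have ha0 : ∀ n, a n 0 = 0 := fun n => by rw [ha]; exact atomReg_zero _ _
  have hamono : ∀ n, Monotone (a n) := fun n => by rw [ha]; exact atomReg_mono _ _
  have hann : ∀ n j, 0 ≤ a n j := fun n j => by rw [ha]; exact atomReg_nonneg (hβ0 n) (hδpos n) (hδ1 n) j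
  have hasum : ∀ n (s : ℝ), 0 < s → Summable fun j => Real.exp (-s * a n j) := fun n s hs => by
    rw [ha]; exact summable_exp_atomReg (hβ0 n) (hδpos n) (hδ1 n) hs
  -- femto step counts `T = ⌈q c_n⌉`
  have hTge : ∀ q : ℝ, 0 < q → ∀ n, q * c n ≤ (femtoSteps q (β n) (L n + 1) : ℝ) := fun q hq n => by
    unfold femtoSteps; rw [hc, ← mul_div_assoc]; exact Nat.le_ceil _
  have hTlt : ∀ q : ℝ, 0 < q → ∀ n, (femtoSteps q (β n) (L n + 1) : ℝ) < q * c n + 1 := fun q hq n => by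
    unfold femtoSteps; rw [hc, ← mul_div_assoc]
    exact Nat.ceil_lt_add_one (div_nonneg (mul_nonneg hq.le (Nat.cast_nonneg _)) (hΛpos n).le)
  have hσlow : ∀ q : ℝ, 0 < q → ∀ n, q ≤ (femtoSteps q (β n) (L n + 1) : ℝ) / c n := fun q hq n => by
    rw [le_div_iff₀ (hcpos n)]; exact hTge q hq n
  have hσup : ∀ q : ℝ, 0 < q → ∀ n, (femtoSteps q (β n) (L n + 1) : ℝ) / c n ≤ q + 1 / c n := fun q hq n => by
    rw [div_le_iff₀ (hcpos n), add_mul, one_div_mul_cancel (hcpos n).ne']; exact (hTlt q hq n).le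
  have hσmin : ∀ q : ℝ, 0 < q → ∀ n, 1 / c n ≤ (femtoSteps q (β n) (L n + 1) : ℝ) / c n := fun q hq n => by
    apply div_le_div_of_nonneg_right _ (hcpos n).le
    have hpos : (0 : ℝ) < femtoSteps q (β n) (L n + 1) := lt_of_lt_of_le (mul_pos hq (hcpos n)) (hTge q hq n)
    have h1 : 1 ≤ femtoSteps q (β n) (L n + 1) :=
      Nat.one_le_iff_ne_zero.mpr fun h0 => by rw [h0] at hpos; simp at hpos
    exact_mod_cast h1
  -- ═══ the Tauberian step: every regularised atom sequence converges to Lüscher's gap ═══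
  have hconv : ∀ j, Tendsto (fun n => a n j) atTop (𝓝 (levelGap j)) := by
    refine Literature.Analysis.Asymptotics.LaplaceAtoms.laplaceAtoms levelGap a levelGap_zero levelGap_mono' hLG
      ha0 hamono hasum ?_
    intro s hs
    have hq : ∀ m, 0 < qgrid (qapprox s m) := fun m => qgrid_pos _
    -- Claim A: at every grid point the regularised dyadic ratio converges to Lüscher's ratio
    have claimA : ∀ m, Tendsto (fun n =>
        |(∑' j, Real.exp (-(2 * ((femtoSteps (qgrid (qapprox s m)) (β n) (L n + 1) : ℝ) / c n)) * a n j)) /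
            (∑' j, Real.exp (-((femtoSteps (qgrid (qapprox s m)) (β n) (L n + 1) : ℝ) / c n) * a n j)) ^ 2 -
          hTraceRatio (qgrid (qapprox s m))|) atTop (𝓝 0) := by
      intro m
      set q : ℝ := qgrid (qapprox s m) with hq_def
      have hq0 : 0 < q := hq m
      obtain ⟨T, hT⟩ : ∃ T : ℕ → ℕ, ∀ n, T n = femtoSteps q (β n) (L n + 1) := ⟨_, fun _ => rfl⟩
      simp only [← hT]
      have hT1 : ∀ n, 1 / c n ≤ (T n : ℝ) / c n := fun n => by rw [hT]; exact hσmin q hq0 n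
      have hTq' : ∀ n, (T n : ℝ) / c n ≤ q + 1 / c n := fun n => by rw [hT]; exact hσup q hq0 n
      have hE1 : ∀ᶠ n in atTop, 2 ≤ T n := by
        filter_upwards [hc_top.eventually (eventually_ge_atTop (2 / q))] with n hn
        have h1 : (2 : ℝ) ≤ q * c n := by rw [div_le_iff₀ hq0] at hn; linarith
        have h2 := hTge q hq0 n
        rw [← hT] at h2
        exact_mod_cast h1.trans h2
      have hE2 : ∀ᶠ n in atTop, 1 ≤ oneSiteCoupling (β n) (L n + 1) := hB_top.eventually (eventually_ge_atTop 1)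
      have hE3 : ∀ᶠ n in atTop, qapprox s m ≤ n := eventually_ge_atTop _
      have hE4 : ∀ᶠ n in atTop, 2 * (q + 1 / c n) ≤ (n : ℝ) + 1 := by
        have h1 : ∀ᶠ n in atTop, 1 / c n ≤ 1 := hc_inv.eventually (eventually_le_nhds one_pos)
        have h2 : ∀ᶠ n : ℕ in atTop, 2 * (q + 1) ≤ (n : ℝ) + 1 := by
          obtain ⟨N, hN⟩ := exists_nat_ge (2 * (q + 1))
          refine eventually_atTop.mpr ⟨N, fun n hn => hN.trans ?_⟩
          have : (N : ℝ) ≤ n := by exact_mod_cast hn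
          linarith
        filter_upwards [h1, h2] with n h1 h2
        linarith
      have hOS1 : Tendsto (fun n => levelRatio 1 (oneSiteCoupling (β n) (L n + 1)) (T n)) atTop (𝓝 (hTraceRatio q)) :=
        tendsto_levelRatio_oneSite hOS hq0 hB_top (fun n => by rw [hT]; exact femtoSteps_mul_sub_le hq0.le (hlam n) (hW n))
      -- the eventual bound
      have hbound : ∀ᶠ n in atTop,
          |(∑' j, Real.exp (-(2 * ((T n : ℝ) / c n)) * a n j)) / (∑' j, Real.exp (-((T n : ℝ) / c n) * a n j)) ^ 2 -
              hTraceRatio q| ≤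
            4 * (1 / ((n : ℝ) + 1)) + |levelRatio 1 (oneSiteCoupling (β n) (L n + 1)) (T n) - hTraceRatio q| := by
        filter_upwards [hE1, hE2, hE3, hE4] with n h1 h2 h3 h4
        have hic : 0 < 1 / c n := one_div_pos.mpr (hcpos n)
        have hσpos : 0 < (T n : ℝ) / c n := lt_of_lt_of_le hic (hT1 n)
        have hσS : (T n : ℝ) / c n ≤ (n : ℝ) + 1 := by linarith [hTq' n]
        have h2T : ((2 * T n : ℕ) : ℝ) / c n = 2 * ((T n : ℝ) / c n) := by push_cast; ring
        have hσS2 : ((2 * T n : ℕ) : ℝ) / c n ≤ (n : ℝ) + 1 := by rw [h2T]; linarith [hTq' n]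
        have hσmin2 : 1 / c n ≤ ((2 * T n : ℕ) : ℝ) / c n := by rw [h2T]; linarith [hT1 n]
        have hD1 := abs_tsum_exp_atomReg_sub_levelMoment_le hTF (hβ1 n) (hcpos n) (hδpos n) (hδ1 n) h1 hic (hT1 n) hσS
          (hS1 n) (hS2 n)
        have hD2 := abs_tsum_exp_atomReg_sub_levelMoment_le hTF (hβ1 n) (hcpos n) (hδpos n) (hδ1 n)
          (by omega : 2 ≤ 2 * T n) hic hσmin2 hσS2 (hS1 n) (hS2 n)
        rw [← ha n] at hD1 hD2
        have e1 : |levelMoment (L n + 1) (β n) (T n) - ∑' j, Real.exp (-((T n : ℝ) / c n) * a n j)| ≤ 1 / ((n : ℝ) + 1) := by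
          rw [abs_sub_comm]; exact hD1.trans (hFG n)
        have e2 : |levelMoment (L n + 1) (β n) (2 * T n) - ∑' j, Real.exp (-(((2 * T n : ℕ) : ℝ) / c n) * a n j)| ≤
            1 / ((n : ℝ) + 1) := by
          rw [abs_sub_comm]; exact hD2.trans (hFG n)
        -- sizes for the ratio perturbation lemma
        have hBge : 1 ≤ levelMoment (L n + 1) (β n) (T n) := by
          have hs := (hasSum_xval_pow (L := L n + 1) hTF (hβ1 n) h1).summable
          have := hs.le_tsum 0 (fun j _ => pow_nonneg (xval_nonneg (L := L n + 1) (hβ0 n) j) _)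
          rw [xval_zero, one_pow] at this
          exact this
        have hB'ge : 1 ≤ ∑' j, Real.exp (-((T n : ℝ) / c n) * a n j) := by
          have := (hasum n _ hσpos).le_tsum 0 (fun j _ => (Real.exp_pos _).le)
          rw [ha0, mul_zero, Real.exp_zero] at this
          exact this
        have hA'nn : 0 ≤ ∑' j, Real.exp (-(((2 * T n : ℕ) : ℝ) / c n) * a n j) := tsum_nonneg fun j => (Real.exp_pos _).le
        have hA'B' : (∑' j, Real.exp (-(((2 * T n : ℕ) : ℝ) / c n) * a n j)) ≤ ∑' j, Real.exp (-((T n : ℝ) / c n) * a n j) := by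
          refine Summable.tsum_le_tsum (fun j => ?_) (hasum n _ (by rw [h2T]; linarith)) (hasum n _ hσpos)
          apply Real.exp_le_exp.mpr
          rw [h2T]
          nlinarith [hann n j]
        have hR := ratio_sub_ratio_le (A := levelMoment (L n + 1) (β n) (2 * T n)) hBge hB'ge hA'nn hA'B'
        -- currency conversions
        have hLR : traceRatio (L n + 1) (β n) (T n) = levelRatio (L n + 1) (β n) (T n) := traceRatio_eq_levelRatio hTF (hβ1 n) h1
        have hLR1 : traceRatio 1 (oneSiteCoupling (β n) (L n + 1)) (T n) = levelRatio 1 (oneSiteCoupling (β n) (L n + 1)) (T n) :=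
          traceRatio_eq_levelRatio hTF h2 h1
        have hTT := hTTS n (qapprox s m) h3
        rw [← hq_def] at hTT
        rw [← hT n, hLR, hLR1] at hTT
        unfold levelRatio at hTT ⊢
        rw [show (2 : ℝ) * ((T n : ℝ) / c n) = ((2 * T n : ℕ) : ℝ) / c n from h2T.symm]
        have t1 := abs_sub_le ((∑' j, Real.exp (-(((2 * T n : ℕ) : ℝ) / c n) * a n j)) /
            (∑' j, Real.exp (-((T n : ℝ) / c n) * a n j)) ^ 2)
          (levelMoment (L n + 1) (β n) (2 * T n) / levelMoment (L n + 1) (β n) (T n) ^ 2) (hTraceRatio q)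
        have t2 := abs_sub_le (levelMoment (L n + 1) (β n) (2 * T n) / levelMoment (L n + 1) (β n) (T n) ^ 2)
          (levelMoment 1 (oneSiteCoupling (β n) (L n + 1)) (2 * T n) / levelMoment 1 (oneSiteCoupling (β n) (L n + 1)) (T n) ^ 2)
          (hTraceRatio q)
        rw [abs_sub_comm] at hR
        linarith
      refine squeeze_zero' (Eventually.of_forall fun n => abs_nonneg _) hbound ?_
      have := (tendsto_one_div_add_atTop_nhds_zero_nat.const_mul (4 : ℝ)).add (tendsto_iff_norm_sub_tendsto_zero.mp hOS1)
      simpa only [mul_zero, zero_add, Real.norm_eq_abs] using this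
    -- diagonal selection over the dyadic approximants of `s`
    obtain ⟨φ, hφ, hφu⟩ := exists_diag claimA
    have hφu' : Tendsto (fun n =>
        |(∑' j, Real.exp (-(2 * ((femtoSteps (qgrid (qapprox s (φ n))) (β n) (L n + 1) : ℝ) / c n)) * a n j)) /
            (∑' j, Real.exp (-((femtoSteps (qgrid (qapprox s (φ n))) (β n) (L n + 1) : ℝ) / c n) * a n j)) ^ 2 -
          hTraceRatio (qgrid (qapprox s (φ n)))|) atTop (𝓝 0) := hφu
    have hh : Tendsto (fun n => hTraceRatio (qgrid (qapprox s (φ n)))) atTop (𝓝 (hTraceRatio s)) :=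
      tendsto_hTraceRatio hs ((tendsto_qgrid_qapprox hs).comp hφ)
    refine ⟨fun n => (femtoSteps (qgrid (qapprox s (φ n))) (β n) (L n + 1) : ℝ) / c n, ?_, ?_⟩
    · -- `σ_n → s`
      have hup : Tendsto (fun n => s + (1 / 2 : ℝ) ^ (φ n) + 1 / c n) atTop (𝓝 s) := by
        have h1 : Tendsto (fun n => (1 / 2 : ℝ) ^ (φ n)) atTop (𝓝 0) :=
          (tendsto_pow_atTop_nhds_zero_of_lt_one (by norm_num) (by norm_num)).comp hφ
        have := ((tendsto_const_nhds (x := s)).add h1).add hc_inv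
        simpa only [add_zero] using this
      refine tendsto_of_tendsto_of_tendsto_of_le_of_le tendsto_const_nhds hup (fun n => ?_) (fun n => ?_)
      · exact (le_qgrid_qapprox hs (φ n)).trans (hσlow _ (hq _) n)
      · have h1 := hσup _ (hq (φ n)) n
        have h2 := qgrid_qapprox_le hs (φ n)
        change (femtoSteps (qgrid (qapprox s (φ n))) (β n) (L n + 1) : ℝ) / c n ≤ s + (1 / 2 : ℝ) ^ (φ n) + 1 / c n
        linarith
    · -- the ratios converge to `r_𝔥(s)`
      change Tendsto (fun n =>
        (∑' j, Real.exp (-(2 * ((femtoSteps (qgrid (qapprox s (φ n))) (β n) (L n + 1) : ℝ) / c n)) * a n j)) /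
          (∑' j, Real.exp (-((femtoSteps (qgrid (qapprox s (φ n))) (β n) (L n + 1) : ℝ) / c n) * a n j)) ^ 2)
        atTop (𝓝 (hTraceRatio s))
      rw [tendsto_iff_norm_sub_tendsto_zero]
      have h0 := hφu'.add (tendsto_iff_norm_sub_tendsto_zero.mp hh)
      rw [add_zero] at h0
      refine squeeze_zero (fun n => norm_nonneg _) (fun n => ?_) h0
      rw [Real.norm_eq_abs, Real.norm_eq_abs]
      exact abs_sub_le _ _ _
  -- ═══ the contradiction at level `k` ═══
  have hk := hconv k
  have hev1 : ∀ᶠ n in atTop, δ n * k ≤ η / 2 := by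
    have : Tendsto (fun n => δ n * k) atTop (𝓝 0) := by simpa using hδ0.mul_const (k : ℝ)
    exact this.eventually (eventually_le_nhds (by positivity : (0 : ℝ) < η / 2))
  have hev2 : ∀ᶠ n in atTop, k ≠ 0 → levelGap k + η ≤ k / δ n := by
    by_cases hk0 : k = 0
    · exact Eventually.of_forall fun n h => absurd hk0 h
    · have hk1 : (1 : ℝ) ≤ k := by exact_mod_cast Nat.one_le_iff_ne_zero.mpr hk0
      have hpos : 0 ≤ levelGap k + η := by linarith [levelGap_nonneg k]
      obtain ⟨N, hN⟩ := exists_nat_ge (levelGap k + η)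
      refine eventually_atTop.mpr ⟨N, fun n hn _ => ?_⟩
      rw [le_div_iff₀ (hδpos n)]
      have hn' : (N : ℝ) ≤ n := by exact_mod_cast hn
      have h1 : (levelGap k + η) * δ n ≤ (n : ℝ) * (1 / ((n : ℝ) + 1)) :=
        mul_le_mul (hN.trans hn') (hδε n) (hδpos n).le (Nat.cast_nonneg n)
      have h2 : (n : ℝ) * (1 / ((n : ℝ) + 1)) ≤ 1 := by
        rw [mul_one_div, div_le_one (by positivity)]; linarith
      linarith
  obtain ⟨N3, hN3⟩ := (Metric.tendsto_atTop.mp hk) (η / 4) (by positivity)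
  obtain ⟨n, hn1, hn2, hn3⟩ := (hev1.and (hev2.and (eventually_ge_atTop N3))).exists
  have hfar := far_of_violation (hβ0 n) (hΛpos n) (hδpos n) hη hn1 hn2 (hV n)
  rw [← hc n, ← ha n] at hfar
  have hnear := hN3 n hn3
  rw [Real.dist_eq] at hnear
  linarith

/-! ## §2 The glue -/

/-- The three TT children give the coarse two-sided Lüscher law `CoarseLevels` for every level. -/
theorem coarseLevels_of_children (hTF : Summit.QuantumFields.YangMills.Theses.LuscherReduction.TraceFormula) (hTS : Summit.QuantumFields.YangMills.Theses.LuscherReduction.TwistedTraceScaling)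
    (hTail : Summit.QuantumFields.YangMills.Theses.LuscherReduction.OneSiteTail) :
    (∀ k : ℕ, ∀ η : ℝ, 0 < η → ∃ lam0 : ℝ, 0 < lam0 ∧ ∀ lam : ℝ, 0 < lam → lam ≤ lam0 →
      ∃ L0 : ℕ, ∀ (L : ℕ) [NeZero L], L0 ≤ L → ∀ β : ℝ, InFemtoWindow lam β L →
        Real.exp (-((levelGap k + η) * luscherLambda β L) / L) * levelValue su2Rep L β 0 ≤ levelValue su2Rep L β k ∧
          levelValue su2Rep L β k ≤ Real.exp (-((levelGap k - η) * luscherLambda β L) / L) * levelValue su2Rep L β 0) :=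
  traceInversion hTF hTS (oneSiteTraceLimit_of_oneSiteTail hTail)

/-- ★★ **Glue item `TraceDoorGlue` (stmt-QuantumFields-20206) BY NAME: `TraceFormula → TwistedTraceScaling → OneSiteTail → DressedRitz →
RunningReduction`** — the TT door of skeleton «KTR» rev 8 (`TT.RunningReduction_of_trace8`) over tree modules only: trace inversion ⟹ `CoarseLevels`
⟹ `CoarseNoIntruder` (`coarseNoIntruder_of_coarseLevels`) ⟹ RED through the KT enclosure composition `runningReduction_of_coarseNoIntruder` fed
with `DressedRitz`. [cite: Luscher1983, §3] [cite: LuscherMunster1984] -/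
theorem traceDoorGlue_proof : Summit.QuantumFields.YangMills.Theses.LuscherReduction.TraceDoorGlue := by
  intro hTF hTS hTail hDR
  exact runningReduction_of_coarseNoIntruder (coarseNoIntruder_of_coarseLevels (coarseLevels_of_children hTF hTS hTail)) hDR


end Summit.QuantumFields.YangMills.Theorems.FemtoTransferGap.TraceDoor

end
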